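/-
Copyright: lit-balaban cell, Phase-2 proof seat p11 (gen 3).  Statement-level skeleton of a published paper; no proof claims beyond
what the kernel checks below.
-/
import Literature.MathematicalPhysics.QuantumFieldTheory.BalabanImbrieJaffe1984to88.BIJ85BlockAveragesTorusK
import Literature.MathematicalPhysics.QuantumFieldTheory.Balaban1983to89.B1RTSemigroup

/-!
# `BalabanImbrieJaffe1984to88.BIJ85ScalarRTComposition` — T. Bałaban, J. Imbrie, A. Jaffe, *Renormalization of the Higgs model:
minimizers, propagators and the stability of mean field theory*, Commun. Math. Phys. **97** (1985) 299–329
[BalabanImbrieJaffe1985]: Sect. 4.6 p. 313, the sentence after (4.6.3) — *"The coefficients a_k are produced by iterating one-step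
renormalization transformations which use a constant a in the Gaussian. This yields a_k = a(1 − L^{−2})(1 − L^{−2k})^{−1} in the
k-step transformation [3]"* — PROVED ON THE TORUS CARRIER OF RECORD for the covariant `U(1)` scalar block averages: the composition of
`k` one-step Gaussian scalar transformations with the averages `Q(u), Q(u^{(1)}), …, Q(u^{(k−1)})` IS the `k`-step Gaussian
transformation with the average `Q_k(u)` (`BIJ85BlockAveragesTorusK.qCovK`) and the coefficient `a_k` — [3] = T. Bałaban, *(Higgs)₂,₃
quantum fields in a finite volume I*, Commun. Math. Phys. **85** (1982) [Balaban1982Higgs1] (2.14)/(2.16), whose ABSTRACT operator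
identities are r14's `Balaban1983to89.B1RTSemigroup.display214` and whose B1-model instance is r14's `B1Eq214Concrete`

statement-level skeleton of published theorems with citation tags; proofs where landed; nothing here is a claim about the Yang–Mills mass gap

PDF held: `paper:balaban1985-cmp97-bij-higgs-minimizers` (journal page = PDF page + 298), p. 313 [PDF 15] read this session (`lit read`);
[Balaban1982Higgs1] = `paper:balaban1982-cmp85-higgs23-i` (journal page = PDF page + 602), pp. 608–609 as quoted in r14's
`B1RTSemigroup`/`B1Eq214Concrete` headers.

CITATION HEADER (lean-in-tree rule).  Phase-2 file of the lit-balaban TYPED SKELETON (HOME `run/shared/lean/pub/lit-balaban/`), seat p11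
gen 3 (unit `lit-balaban-p11-g3`; owner r15, referee ref-5): the `a_k` SENTENCE of row **C1.Eq4.6.2-4.6.4** (gen 2 proved it BY REFERENCE,
`BIJ85CoefficientAk464.kStep_constant_eq_aK` = r14's abstract `B1RTSemigroup.display216` read with C1's `a_k`) as a CONCRETE theorem for
the torus model instance of gen 3 (`BIJ85BlockAveragesTorusK`/`BIJ85ScalarPropagatorTorusK`, p249589/p249871): KNITTING rows
**B1.Eq2.14** / **B1.Eq2.16** (owner r14) with C1 Sect. 4.6 on the carriers of record of C1/C2 (`Setup` tori, `U(1)` bond variables).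
The route is r14's `B1Eq214Concrete` verbatim with `HiggsLattice`/`U(A(Γ))` replaced by `Setup`/`u(Γ)`: block parametrisation
`T^{(ℓ)} ≃ T^{(ℓ+1)} × {0,…,L−1}^d` (`siteEquiv`, from r18's `offs`/`blockSite_offs` and `TorusGeometry`'s `Site.blockSite`), transport of the
field integrals (`MeasureTheory.volume_measurePreserving_piCongrLeft`), `B1RTSemigroup.display214` with `|B| = L^d`, the transports
`u^{(k)}(Γ_{zy})` as rotations of `ℂ` (Mathlib `rotation`, r18's `holCircle`), the composition `Q(u^{(k)}) ∘ Q_k(u) = Q_{k+1}(u)`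
(DEFINITIONAL for `qCovK`), and the precision bookkeeping `B1RT.prec_comp` + `B1.aSeq_succ`.

THE PRINTED TEXT, verbatim (p. 313 [PDF 15]): *"G_k(u_k) = [−Δ_{u_k} + a_kQ_k^*(u_k)Q_k(u_k)]^{−1}, (4.6.2) where −Δ_{u_k} = D^*_{u_k}D_{u_k}.
(4.6.3) The coefficients a_k are produced by iterating one-step renormalization transformations which use a constant a in the
Gaussian. This yields a_k = a(1 − L^{−2})(1 − L^{−2k})^{−1} in the k-step transformation [3]."*; [Balaban1982Higgs1] p. 609 [PDF 7]:
*"T^{L^kε}_{a,L,A}T^ε_{a_k,L^k,A} = T^ε_{a_{k+1},L^{k+1},A}. (2.14) … T^{L^{k−1}ε}_{a,L,A} … T^{Lε}_{a,L,A}T^ε_{a,L,A} = T^ε_{a_k,L^k,A}. (2.16)"*.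

WHAT IS DEFINED (defs with bodies) / PROVED (0 `sorry`, standard axioms, no `def … : Prop`).  Carriers: `Balaban1983to89.Site P ℓ`
(level `j` = the `η`-lattice, level `j + k` = the unit lattice), `U : GaugeField P j U1`, scalar fields `HiggsField P ℓ = Site P ℓ → ℂ`
with the product Lebesgue measures `dφ`, r14's Gaussian single-site kernel `B1RT.rtKernel κ v = (κ/2π)^{N/2}e^{−½κ|v|²}` (here `V = ℂ`,
`N = 2`), block kernel `B1RT.blockKernel`, operator `B1RT.rtOp` ((2.4)–(2.6)/(2.10) of [3]), precisions `B1RT.prec a ℓ d = aℓ^{d−2}`,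
`B1RT.compPrec`, the sequence `B1.aSeq a L k = a(1 − L^{−2})/(1 − L^{−2k})` ((2.15) of [3] = C1's a_k), the lattice spacings
`Params.spacing ℓ = L^ℓε` of `TorusGeometry`.
* §1 the block parametrisation `siteEquiv : Site P ℓ ≃ Site P (ℓ+1) × (Fin d → Fin L)`, `x ↦ (blockOf x, offs x)` (r18), inverse
  `Site.blockSite` (`TorusGeometry`); `sum_block_eq_sum_blockSite`.
* §2 the transports `uQ v (z, r)` = multiplication by `v(Γ_{z,blockSite z r})` as a linear isometry of `ℂ` (`rotation (holCircle v _)`), the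
  field transport `fieldEquiv` (measure preserving), `qCov_fieldEquiv` (r18's (2.6) in block coordinates IS r14's `qAvg L^{−d} uQ`),
  `mQk U k` (= `Q_k(u)φ` in block coordinates), `blockKernel_qCov_fieldEquiv`, `blockKernel_qCovK_fieldEquiv`.
* §3 **the transformations**: `scalarRT κ v ρ` = the ONE-STEP Gaussian scalar transformation with the covariant average (2.6),
  `(T_{κ,v}ρ)(ψ) = ∫dφ Π_y t_κ(ψ(y) − (Q(v)φ)(y)) ρ(φ)`; `scalarRTK κ U k ρ` = the `k`-STEP one with `Q_k(u)`; and **(2.14) of [3] for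
  them**: `scalarRT_scalarRTK` — `T_{α,u^{(k)}}(T^{(k)}_{β,u}ρ) = T^{(k+1)}_{γ,u}ρ`, `γ = compPrec α β L^{−d} L^d`, for all `α, β > 0`, every
  `U(1)` field `u`, every integrable density `ρ` (standing range `j + k + 1 ≤ m + K`).
* §4 **(2.16) of [3] / the a_k sentence of C1 (4.6.4)**: `scalarRTChain U κ k` = the composition `T_{κ_{k−1},u^{(k−1)}} ∘ ⋯ ∘ T_{κ₀,u}`;
  `scalarRTChain_eq` (any positive precisions: the chain IS the `k`-step transformation with the composed precision `chainPrec`);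
  **`scalarRTChain_printed`**: with the printed one-step constants `κ_i = a(L^{i+1}η)^{d−2}` (*"a constant a in the Gaussian"*, `η` =
  the spacing of level `j`) the `k`-step transformation has the constant `a_k(L^kη)^{d−2}`, `a_k = B1.aSeq a L k`; and
  **`scalarRTChain_unitLattice`**: when level `j + k` is the unit lattice (`j + k = K`, spacing `1`) the `k`-step Gaussian has EXACTLY the
  coefficient `a_k = a(1 − L^{−2})(1 − L^{−2k})^{−1}` multiplying `|ψ − Q_k(u)φ|²` — the printed sentence.
Honest scope: the one-step constants are those of [3] (2.6) ((L^{i+1}η)^{d−2}-weighted); C1 does not print its normalization of the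
one-step Gaussian beyond *"a constant a"*; the identification is the one gen 2 recorded in `BIJ85CoefficientAk464`.
-/

open scoped BigOperators
open MeasureTheory Finset

namespace Literature.MathematicalPhysics.QuantumFieldTheory.BalabanImbrieJaffe1984to88.BIJ85ScalarRTComposition

open Literature.MathematicalPhysics.QuantumFieldTheory.Balaban1983to89
open BIJ88Sect3Statements (U1 toC)
open BIJ85Sect1Model (HiggsField)
open BIJ88RenormTransf311 (inBlock)
open BIJ85BlockAveragesTorus BIJ85BlockAveragesTorusK
open B1RT B1RTSemigroup

noncomputable section

variable {P : Params} {j ℓ : ℕ}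

/-! ## §1 The block parametrisation `T^{(ℓ)} ≃ T^{(ℓ+1)} × {0,…,L−1}^d` of the torus of record -/

/-- **The block parametrisation** `x ↦ (blockOf x, offs x)` with inverse `(z, r) ↦ blockSite z r` (standing range `ℓ + 1 ≤ m + K`): the
middle lattice of [3] (2.14) IS the product `Z × B` of r14's `B1RTSemigroup.Display214` with `|B| = L^d`. [cite: BalabanImbrieJaffe1985, (2.4) p.302] -/
def siteEquiv (hℓ : ℓ + 1 ≤ P.m + P.K) : Balaban1983to89.Site P ℓ ≃ Balaban1983to89.Site P (ℓ+1) × (Fin P.d → Fin P.L) where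
  toFun x := (blockOf x, offs x)
  invFun p := Balaban1983to89.Site.blockSite p.1 p.2
  left_inv x := blockSite_offs hℓ x
  right_inv p := by
    refine Prod.ext (Balaban1983to89.Site.blockOf_blockSite hℓ p.1 p.2) (funext fun κ => Fin.ext ?_)
    show inBlock (Balaban1983to89.Site.blockSite p.1 p.2) κ = (p.2 κ : ℕ)
    exact inBlock_blockSite hℓ p.1 p.2 κ

/-- kernel: the parametrisation reads off block and offsets. [cite: BalabanImbrieJaffe1985, (2.4) p.302] -/
theorem siteEquiv_apply (hℓ : ℓ + 1 ≤ P.m + P.K) (x : Balaban1983to89.Site P ℓ) : siteEquiv hℓ x = (blockOf x, offs x) := rfl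

/-- kernel: its inverse is `blockSite`. [cite: BalabanImbrieJaffe1985, (2.4) p.302] -/
theorem siteEquiv_symm_apply (hℓ : ℓ + 1 ≤ P.m + P.K) (p : Balaban1983to89.Site P (ℓ+1) × (Fin P.d → Fin P.L)) :
    (siteEquiv hℓ).symm p = Balaban1983to89.Site.blockSite p.1 p.2 := rfl

/-- kernel: `siteEquiv (blockSite z r) = (z, r)`. [cite: BalabanImbrieJaffe1985, (2.4) p.302] -/
theorem siteEquiv_blockSite (hℓ : ℓ + 1 ≤ P.m + P.K) (z : Balaban1983to89.Site P (ℓ+1)) (r : Fin P.d → Fin P.L) :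
    siteEquiv hℓ (Balaban1983to89.Site.blockSite z r) = (z, r) :=
  (siteEquiv hℓ).apply_symm_apply (z, r)

/-- The block `B(z)` as the image of the offsets: `Σ_{x∈B(z)} F(x) = Σ_r F(blockSite z r)`. [cite: BalabanImbrieJaffe1985, (2.4) p.302] -/
theorem sum_block_eq_sum_blockSite (hℓ : ℓ + 1 ≤ P.m + P.K) {M : Type*} [AddCommMonoid M] (z : Balaban1983to89.Site P (ℓ+1))
    (F : Balaban1983to89.Site P ℓ → M) :
    ∑ x ∈ block z, F x = ∑ r : Fin P.d → Fin P.L, F (Balaban1983to89.Site.blockSite z r) := by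
  have himage : block z = univ.image (Balaban1983to89.Site.blockSite z) := by
    ext x
    simp only [mem_block_iff, mem_image, mem_univ, true_and]
    constructor
    · intro hx
      exact ⟨offs x, by rw [← hx, blockSite_offs hℓ x]⟩
    · rintro ⟨r, rfl⟩
      exact Balaban1983to89.Site.blockOf_blockSite hℓ z r
  rw [himage, sum_image]
  intro r _ r' _ h
  have e := congrArg (fun x => (siteEquiv hℓ x).2) h
  simpa only [siteEquiv_blockSite] using e

/-! ## §2 The transports as rotations of `ℂ`; fields in block coordinates -/

/-- The transports `v(Γ_{z,x})` of (2.6) at `x = blockSite z r`, packaged as linear isometries of `ℂ` (multiplication by a unit complex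
number: Mathlib's `rotation` of r18's `holCircle`). [cite: BalabanImbrieJaffe1985, (2.6) p.303] -/
def uQ (v : GaugeField P ℓ U1) (p : Balaban1983to89.Site P (ℓ+1) × (Fin P.d → Fin P.L)) : ℂ ≃ₗᵢ[ℝ] ℂ :=
  rotation (holCircle v (Balaban1983to89.Site.blockSite p.1 p.2))

/-- kernel: `uQ v (z,r)` multiplies by `v(Γ_{z,blockSite z r})`. [cite: BalabanImbrieJaffe1985, (2.6) p.303] -/
theorem uQ_apply (v : GaugeField P ℓ U1) (p : Balaban1983to89.Site P (ℓ+1) × (Fin P.d → Fin P.L)) (c : ℂ) :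
    uQ v p c = holC v (Balaban1983to89.Site.blockSite p.1 p.2) * c := by
  rw [uQ, rotation_apply, coe_holCircle]

/-- The field transport along the block parametrisation: a field on `T^{(ℓ+1)} × offsets` IS a field on `T^{(ℓ)}`.
[cite: BalabanImbrieJaffe1985, (2.4) p.302] -/
def fieldEquiv (hℓ : ℓ + 1 ≤ P.m + P.K) :
    (Balaban1983to89.Site P (ℓ+1) × (Fin P.d → Fin P.L) → ℂ) ≃ᵐ HiggsField P ℓ :=
  MeasurableEquiv.piCongrLeft (fun _ : Balaban1983to89.Site P ℓ => ℂ) (siteEquiv hℓ).symm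

/-- kernel: `(fieldEquiv g)(x) = g(blockOf x, offs x)`. [cite: BalabanImbrieJaffe1985, (2.4) p.302] -/
theorem fieldEquiv_apply (hℓ : ℓ + 1 ≤ P.m + P.K) (g : Balaban1983to89.Site P (ℓ+1) × (Fin P.d → Fin P.L) → ℂ)
    (x : Balaban1983to89.Site P ℓ) : fieldEquiv hℓ g x = g (siteEquiv hℓ x) := by
  have hx : x = (siteEquiv hℓ).symm (siteEquiv hℓ x) := ((siteEquiv hℓ).symm_apply_apply x).symm
  conv_lhs => rw [hx]
  rw [fieldEquiv, MeasurableEquiv.coe_piCongrLeft, Equiv.piCongrLeft_apply_apply]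

/-- kernel: `fieldEquiv` preserves the Lebesgue measures `dφ`. [cite: BalabanImbrieJaffe1985, (4.6.1) p.313] -/
theorem measurePreserving_fieldEquiv (hℓ : ℓ + 1 ≤ P.m + P.K) : MeasurePreserving (fieldEquiv (P := P) hℓ) volume volume :=
  volume_measurePreserving_piCongrLeft (fun _ : Balaban1983to89.Site P ℓ => ℂ) (siteEquiv hℓ).symm

/-- **r18's (2.6) in block coordinates IS r14's product-model average**: `Q(v)(fieldEquiv g)(z) = qAvg L^{−d} (uQ v) g z`.
[cite: BalabanImbrieJaffe1985, (2.6) p.303] -/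
theorem qCov_fieldEquiv (hℓ : ℓ + 1 ≤ P.m + P.K) (v : GaugeField P ℓ U1)
    (g : Balaban1983to89.Site P (ℓ+1) × (Fin P.d → Fin P.L) → ℂ) (z : Balaban1983to89.Site P (ℓ+1)) :
    qCov v (fieldEquiv hℓ g) z = qAvg (((P.L : ℝ) ^ P.d)⁻¹) (uQ v) g z := by
  rw [qCov_apply, qAvg_apply, sum_block_eq_sum_blockSite hℓ, Complex.real_smul]
  push_cast
  congr 1
  refine sum_congr rfl fun r _ => ?_
  rw [fieldEquiv_apply, siteEquiv_blockSite, uQ_apply]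

/-- `Q_k(u)φ` in block coordinates of the level `j + k`: `mQk U k φ (z, r) = (Q_k(u)φ)(blockSite z r)`. [cite: BalabanImbrieJaffe1985, (4.6.1) p.313] -/
def mQk (U : GaugeField P j U1) (k : ℕ) (φ : HiggsField P j) (p : Balaban1983to89.Site P (j+k+1) × (Fin P.d → Fin P.L)) : ℂ :=
  qCovK U k φ (Balaban1983to89.Site.blockSite p.1 p.2)

/-- kernel: `fieldEquiv (mQk φ) = Q_k(u)φ`. [cite: BalabanImbrieJaffe1985, (4.6.1) p.313] -/
theorem fieldEquiv_mQk {k : ℕ} (hk : j + k + 1 ≤ P.m + P.K) (U : GaugeField P j U1) (φ : HiggsField P j) :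
    fieldEquiv hk (mQk U k φ) = qCovK U k φ := by
  funext x
  rw [fieldEquiv_apply, mQk, siteEquiv_apply]
  show qCovK U k φ (Balaban1983to89.Site.blockSite (blockOf x) (offs x)) = qCovK U k φ x
  rw [blockSite_offs hk]

/-- kernel: `mQk` is continuous (linear) in the fine field (the formula `qCovK_apply`). [cite: BalabanImbrieJaffe1985, (4.6.1) p.313] -/
theorem continuous_mQk (U : GaugeField P j U1) (k : ℕ) : Continuous (mQk U k) := by
  refine continuous_pi fun p => ?_
  show Continuous fun φ : HiggsField P j => qCovK U k φ (Balaban1983to89.Site.blockSite p.1 p.2)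
  simp only [qCovK_apply]
  exact continuous_const.mul (continuous_finsetSum _ fun x _ => continuous_const.mul (continuous_apply x))

/-- kernel: the one-step block kernel with r18's (2.6), on a transported middle field, IS the product-model kernel
`blockKernel κ (qAvg L^{−d} uQ)`. [cite: BalabanImbrieJaffe1985, (4.6.1) p.313] -/
theorem blockKernel_qCov_fieldEquiv (hℓ : ℓ + 1 ≤ P.m + P.K) (κ : ℝ) (v : GaugeField P ℓ U1) (ψ : HiggsField P (ℓ+1))
    (g : Balaban1983to89.Site P (ℓ+1) × (Fin P.d → Fin P.L) → ℂ) :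
    blockKernel κ (qCov v) ψ (fieldEquiv hℓ g) = blockKernel κ (qAvg (((P.L : ℝ) ^ P.d)⁻¹) (uQ v)) ψ g := by
  simp only [blockKernel_eq, qCov_fieldEquiv hℓ]

/-- kernel: the `k`-step block kernel with `Q_k(u)`, at a transported middle field, IS the product-model kernel `blockKernel κ mQk`.
[cite: BalabanImbrieJaffe1985, (4.6.1) p.313] -/
theorem blockKernel_qCovK_fieldEquiv {k : ℕ} (hk : j + k + 1 ≤ P.m + P.K) (κ : ℝ) (U : GaugeField P j U1)
    (g : Balaban1983to89.Site P (j+k+1) × (Fin P.d → Fin P.L) → ℂ) (φ : HiggsField P j) :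
    blockKernel κ (qCovK U k) (fieldEquiv hk g) φ = blockKernel κ (mQk U k) g φ := by
  simp only [blockKernel_eq]
  refine Fintype.prod_equiv (siteEquiv hk) _ _ fun x => ?_
  rw [fieldEquiv_apply, mQk]
  show rtKernel κ (g (siteEquiv hk x) - qCovK U k φ x)
      = rtKernel κ (g (siteEquiv hk x) - qCovK U k φ (Balaban1983to89.Site.blockSite (blockOf x) (offs x)))
  rw [blockSite_offs hk]

/-! ## §3 The one-step and the `k`-step Gaussian scalar transformations with covariant averages; (2.14) of [3] for them -/

/-- **The one-step Gaussian scalar transformation with the covariant average (2.6)**: `(T_{κ,v}ρ)(ψ) = ∫dφ Π_{y∈T^{(ℓ+1)}} t_κ(ψ(y) −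
(Q(v)φ)(y)) ρ(φ)`, `t_κ(w) = (κ/2π)e^{−½κ|w|²}` on `ℂ` — *"one-step renormalization transformations which use a constant a in the
Gaussian"* ([3] (2.4)–(2.6): `κ = a(Lη)^{d−2}`; r14's `B1RT.rtOp`/`blockKernel` with r18's `qCov`). [cite: BalabanImbrieJaffe1985, (4.6.3) p.313] -/
def scalarRT (κ : ℝ) (v : GaugeField P ℓ U1) (ρ : HiggsField P ℓ → ℝ) : HiggsField P (ℓ+1) → ℝ :=
  rtOp (blockKernel κ (qCov v)) ρ

/-- **The `k`-step Gaussian scalar transformation with the `k`-level average `Q_k(u)`**: `(T^{(k)}_{κ,u}ρ)(ψ) = ∫dφ Π_{y∈T^{(j+k)}} t_κ(ψ(y) −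
(Q_k(u)φ)(y)) ρ(φ)` — *"the k-step transformation [3]"* ([3] (2.10): `κ = a_k(L^kη)^{d−2}`). [cite: BalabanImbrieJaffe1985, (4.6.3) p.313] -/
def scalarRTK (κ : ℝ) (U : GaugeField P j U1) (k : ℕ) (ρ : HiggsField P j → ℝ) : HiggsField P (j+k) → ℝ :=
  rtOp (blockKernel κ (qCovK U k)) ρ

/-- kernel: unfolding `scalarRT`. [cite: BalabanImbrieJaffe1985, (4.6.3) p.313] -/
theorem scalarRT_apply (κ : ℝ) (v : GaugeField P ℓ U1) (ρ : HiggsField P ℓ → ℝ) (ψ : HiggsField P (ℓ+1)) :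
    scalarRT κ v ρ ψ = ∫ φ, (∏ y, rtKernel κ (ψ y - qCov v φ y)) * ρ φ := rfl

/-- kernel: unfolding `scalarRTK`. [cite: BalabanImbrieJaffe1985, (4.6.3) p.313] -/
theorem scalarRTK_apply (κ : ℝ) (U : GaugeField P j U1) (k : ℕ) (ρ : HiggsField P j → ℝ) (ψ : HiggsField P (j+k)) :
    scalarRTK κ U k ρ ψ = ∫ φ, (∏ y, rtKernel κ (ψ y - qCovK U k φ y)) * ρ φ := rfl

/-- kernel: the one-step transformation IS the `1`-step one (`Q_1(u) = Q(u)`). [cite: BalabanImbrieJaffe1985, (4.6.3) p.313] -/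
theorem scalarRTK_one (κ : ℝ) (U : GaugeField P j U1) (ρ : HiggsField P j → ℝ) : scalarRTK κ U 1 ρ = scalarRT κ U ρ := rfl

/-- **(2.14) of [3] for the covariant `U(1)` averages on the torus**: for all precisions `α, β > 0`, every gauge field `u`, every integrable
density `ρ` of the level-`j` fields (standing range `j + k + 1 ≤ m + K`), the one-step transformation with `Q(u^{(k)})` applied after
the `k`-step transformation with `Q_k(u)` IS the `(k+1)`-step transformation with `Q_{k+1}(u)` and the composed precision
`γ = αβ/(β + L^d·L^{−2d}α)` — r14's `B1RTSemigroup.display214` transported along `fieldEquiv`, the composition `Q(u^{(k)})∘Q_k(u) =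
Q_{k+1}(u)` being definitional. [cite: BalabanImbrieJaffe1985, (4.6.3) p.313] -/
theorem scalarRT_scalarRTK {α β : ℝ} (hα : 0 < α) (hβ : 0 < β) {k : ℕ} (hk : j + k + 1 ≤ P.m + P.K) (U : GaugeField P j U1)
    {ρ : HiggsField P j → ℝ} (hρ : Integrable ρ) :
    scalarRT α (lineIter U k) (scalarRTK β U k ρ)
      = scalarRTK (compPrec α β (((P.L : ℝ) ^ P.d)⁻¹) (Fintype.card (Fin P.d → Fin P.L))) U (k+1) ρ := by
  set w : ℝ := ((P.L : ℝ) ^ P.d)⁻¹ with hw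
  have h214 := display214 (V := ℂ) hα hβ w (uQ (lineIter U k)) (continuous_mQk U k).measurable hρ
  rw [display214_iff] at h214
  funext ψ
  have hmp := measurePreserving_fieldEquiv (P := P) hk
  have hL1 : scalarRT α (lineIter U k) (scalarRTK β U k ρ) ψ
      = ∫ g, blockKernel α (qAvg w (uQ (lineIter U k))) ψ g * ∫ φ, blockKernel β (mQk U k) g φ * ρ φ := by
    rw [scalarRT, rtOp_eq, ← hmp.integral_comp']
    refine integral_congr_ae (Filter.Eventually.of_forall fun g => ?_)
    simp only [scalarRTK, rtOp_eq]
    rw [blockKernel_qCov_fieldEquiv hk α (lineIter U k) ψ g]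
    congr 1
    refine integral_congr_ae (Filter.Eventually.of_forall fun φ => ?_)
    dsimp only
    rw [blockKernel_qCovK_fieldEquiv hk β U g φ]
  have hR : scalarRTK (compPrec α β w (Fintype.card (Fin P.d → Fin P.L))) U (k+1) ρ ψ
      = ∫ φ, blockKernel (compPrec α β w (Fintype.card (Fin P.d → Fin P.L)))
          (fun φ => qAvg w (uQ (lineIter U k)) (mQk U k φ)) ψ φ * ρ φ := by
    rw [scalarRTK, rtOp_eq]
    refine integral_congr_ae (Filter.Eventually.of_forall fun φ => ?_)
    dsimp only
    congr 1
    rw [blockKernel_eq, blockKernel_eq]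
    refine prod_congr rfl fun z _ => ?_
    rw [← qCov_fieldEquiv hk, fieldEquiv_mQk hk, qCovK_succ]
  rw [hL1, hR]
  exact h214 ψ

/-! ## §4 (2.16) of [3]: the chain of one-step transformations; the printed constants; a_k on the unit lattice -/

/-- **The chain** `T_{κ_{k−1},u^{(k−1)}} ∘ ⋯ ∘ T_{κ₁,u^{(1)}} ∘ T_{κ₀,u}` of one-step transformations (the left side of [3] (2.16) for the
covariant averages; `k = 0`: the identity). [cite: BalabanImbrieJaffe1985, (4.6.3) p.313] -/
def scalarRTChain (U : GaugeField P j U1) (κ : ℕ → ℝ) : (k : ℕ) → (HiggsField P j → ℝ) → HiggsField P (j+k) → ℝ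
  | 0, ρ => ρ
  | k + 1, ρ => scalarRT (κ k) (lineIter U k) (scalarRTChain U κ k ρ)

/-- The composed precision of a chain of `k ≥ 1` one-step transformations with precisions `κ₀, κ₁, …` over blocks of `L^d` sites
(`γ₁ = κ₀`, `γ_{k+1} = compPrec κ_k γ_k L^{−d} L^d`; r14's (2.13) recursion). [cite: BalabanImbrieJaffe1985, (4.6.3) p.313] -/
def chainPrec (P : Params) (κ : ℕ → ℝ) : ℕ → ℝ
  | 0 => 0
  | 1 => κ 0
  | k + 2 => compPrec (κ (k+1)) (chainPrec P κ (k+1)) (((P.L : ℝ) ^ P.d)⁻¹) (Fintype.card (Fin P.d → Fin P.L))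

/-- kernel: the composed precision is positive for positive one-step precisions (`k ≥ 1`). [cite: BalabanImbrieJaffe1985, (4.6.3) p.313] -/
theorem chainPrec_pos (κ : ℕ → ℝ) (hκ : ∀ i, 0 < κ i) : ∀ k : ℕ, 1 ≤ k → 0 < chainPrec P κ k
  | 0, h => absurd h (by omega)
  | 1, _ => hκ 0
  | k + 2, _ => compPrec_pos (hκ (k+1)) (chainPrec_pos κ hκ (k+1) (by omega)) _ _

/-- **(2.16) of [3] for the covariant `U(1)` averages on the torus, any positive one-step precisions**: the chain of `k ≥ 1` one-step
Gaussian transformations with `Q(u), Q(u^{(1)}), …, Q(u^{(k−1)})` IS the `k`-step transformation with `Q_k(u)` and the composed precision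
(induction on `k` by `scalarRT_scalarRTK`; integrable `ρ`, `j + k ≤ m + K`). [cite: BalabanImbrieJaffe1985, (4.6.3) p.313] -/
theorem scalarRTChain_eq (U : GaugeField P j U1) {κ : ℕ → ℝ} (hκ : ∀ i, 0 < κ i) {ρ : HiggsField P j → ℝ} (hρ : Integrable ρ) :
    ∀ {k : ℕ}, 1 ≤ k → j + k ≤ P.m + P.K → scalarRTChain U κ k ρ = scalarRTK (chainPrec P κ k) U k ρ
  | 0, h, _ => absurd h (by omega)
  | 1, _, _ => rfl
  | k + 2, _, hK => by
    rw [scalarRTChain, scalarRTChain_eq U hκ hρ (k := k + 1) (by omega) (by omega),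
      scalarRT_scalarRTK (hκ (k+1)) (chainPrec_pos κ hκ (k+1) (by omega)) (by omega) U hρ]
    rfl

/-- The precision bookkeeping of [3] (2.13) on the torus: composing `a(L·s)^{d−2}` (one step onto the lattice of spacing `L·s`) with
`a_ks^{d−2}` (`k` steps onto the lattice of spacing `s`) over blocks of `L^d` sites with weight `L^{−d}` gives `a_{k+1}(L·s)^{d−2}`
(r14's `B1RT.prec_comp` + `aNext_eq_aSeq_succ`). [cite: BalabanImbrieJaffe1985, (4.6.3) p.313] -/
theorem compPrec_printed {a : ℝ} (ha : 0 < a) {k : ℕ} (hk : 1 ≤ k) (n : ℕ) :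
    compPrec (prec a (P.spacing (n+1)) P.d) (prec (B1.aSeq a P.L k) (P.spacing n) P.d) (((P.L : ℝ) ^ P.d)⁻¹)
        (Fintype.card (Fin P.d → Fin P.L))
      = prec (B1.aSeq a P.L (k+1)) (P.spacing (n+1)) P.d := by
  have hL' : (1 : ℝ) < P.L := by exact_mod_cast P.hL.2
  rw [Fintype.card_fun, Fintype.card_fin, Fintype.card_fin, P.spacing_succ,
    prec_comp ha (B1.aSeq_pos ha hL' hk) P.L_pos (P.spacing_pos n), aNext_eq_aSeq_succ ha hL' hk]

/-- kernel: with the printed one-step constants `κ_i = a(spacing (j+i+1))^{d−2}` the composed precision of the `k`-chain (`k ≥ 1`) is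
`a_k(spacing (j+k))^{d−2}`, `a_k = B1.aSeq a L k` (`a₁ = a`, [3] (2.15)). [cite: BalabanImbrieJaffe1985, (4.6.3) p.313] -/
theorem chainPrec_printed {a : ℝ} (ha : 0 < a) :
    ∀ {k : ℕ}, 1 ≤ k → chainPrec P (fun i => prec a (P.spacing (j+i+1)) P.d) k = prec (B1.aSeq a P.L k) (P.spacing (j+k)) P.d
  | 0, h => absurd h (by omega)
  | 1, _ => by
    have hL' : (1 : ℝ) < P.L := by exact_mod_cast P.hL.2
    show prec a (P.spacing (j+0+1)) P.d = _
    rw [B1.aSeq_one hL']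
  | k + 2, _ => by
    show compPrec (prec a (P.spacing (j+(k+1)+1)) P.d) (chainPrec P _ (k+1)) _ _ = _
    rw [chainPrec_printed ha (k := k + 1) (by omega),
      show j + (k + 1) + 1 = (j + (k + 1)) + 1 from rfl, compPrec_printed ha (by omega)]
    rfl

/-- **The a_k SENTENCE of (4.6.4), CONCRETE on the torus**: *"The coefficients a_k are produced by iterating one-step renormalization
transformations which use a constant a in the Gaussian … in the k-step transformation [3]"* — the chain of the `k` one-step Gaussian scalar
transformations with constant `a` ([3]'s normalization `a(L^{i+1}η)^{d−2}`, `η` = the spacing of level `j`) and the covariant averages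
`Q(u), …, Q(u^{(k−1)})` EQUALS the `k`-step transformation with the average `Q_k(u)` and the constant `a_k(L^kη)^{d−2}`, `a_k = a(1 −
L^{−2})/(1 − L^{−2k})` (`B1.aSeq`), for every `U(1)` field `u`, `a > 0`, `1 ≤ k`, `j + k ≤ m + K`, integrable `ρ`.
[cite: BalabanImbrieJaffe1985, (4.6.4) p.313] -/
theorem scalarRTChain_printed (U : GaugeField P j U1) {a : ℝ} (ha : 0 < a) {ρ : HiggsField P j → ℝ} (hρ : Integrable ρ)
    {k : ℕ} (hk1 : 1 ≤ k) (hk : j + k ≤ P.m + P.K) :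
    scalarRTChain U (fun i => prec a (P.spacing (j+i+1)) P.d) k ρ = scalarRTK (prec (B1.aSeq a P.L k) (P.spacing (j+k)) P.d) U k ρ := by
  rw [scalarRTChain_eq U (fun i => prec_pos ha (P.spacing_pos _) P.d) hρ hk1 hk, chainPrec_printed ha hk1]

/-- **… with EXACTLY the coefficient `a_k = a(1 − L^{−2})(1 − L^{−2k})^{−1}` on the unit lattice**: when level `j + k` is the unit lattice
`T₁` of the series (`j + k = K`, spacing `1`; level `j` is then the `η = L^{−k}` lattice of Sect. 4.6), the `k`-step Gaussian produced by the
chain is `Π_y (a_k/2π) exp(−½a_k|ψ(y) − (Q_k(u)φ)(y)|²)` with `a_k = B1.aSeq a L k = a(1 − L^{−2})/(1 − (L^{−2})^k)`.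
[cite: BalabanImbrieJaffe1985, (4.6.4) p.313] -/
theorem scalarRTChain_unitLattice (U : GaugeField P j U1) {a : ℝ} (ha : 0 < a) {ρ : HiggsField P j → ℝ} (hρ : Integrable ρ)
    {k : ℕ} (hk1 : 1 ≤ k) (hjk : j + k = P.K) :
    scalarRTChain U (fun i => prec a (P.spacing (j+i+1)) P.d) k ρ
      = scalarRTK (a * (1 - ((P.L : ℝ) ^ 2)⁻¹) / (1 - (((P.L : ℝ) ^ 2)⁻¹) ^ k)) U k ρ := by
  have hs : P.spacing (j + k) = 1 := by rw [hjk]; exact P.spacing_K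
  rw [scalarRTChain_printed U ha hρ hk1 (by omega), hs, prec, one_zpow, mul_one, B1.aSeq_eq]

end

end Literature.MathematicalPhysics.QuantumFieldTheory.BalabanImbrieJaffe1984to88.BIJ85ScalarRTComposition
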